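import Literature.LinearAlgebra.Matrix.RotationThreeShears
import HarnessLib

/-!
# The split torus of `SL(2,ℝ)` consists of commutators; characters kill it

Topic `LinearAlgebra/Matrix`; namespace `Literature.LinearAlgebra.Matrix.RotationThreeShears` (continuation of that
file's `SL(2,ℝ)` vocabulary `slDiag`, `slWeyl`).  Proved lemmas only ([folklore]): no records, no named facts.

* `slWeyl_mul_slDiag_mul_slWeyl_inv` — the Weyl element inverts the split torus: `w · D(a) · w⁻¹ = D(a⁻¹)`;
* `slDiag_inv` — `D(a)⁻¹ = D(a⁻¹)`;
* `slDiag_eq_commutator` — for `a > 0`, `D(a) = w · D(b) · w⁻¹ · D(b)⁻¹` with `b = (√a)⁻¹`: every element of the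
  identity component of the split torus is ONE commutator;
* `map_slDiag_eq_one` — hence every homomorphism of `SL(2,ℝ)` into a commutative group is trivial on `D(a)`, `a > 0`
  (in particular every continuous character `SL(2,ℝ) → ℂˣ` is `1` on the hyperbolic one-parameter subgroup
  `t ↦ D(e^t)`; `map_slDiag_exp_eq_one`).

Use (pub-hodgecm, model-construction junction (J-arch) §3, BINDER-TRIAGE §50/HANDOFF-g6 §6 of the binder-2 lane): an
archimedean Weil operator family that is a HOMOMORPHISM and agrees with a reference family up to a character agrees
with it EXACTLY on the boosts `a_t = φ(D(e^t))` of `U(1,1) ⊃ SU(1,1) ≅ SL(2,ℝ)` — no phase can survive on a commutator.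
References: [Lang1985] S. Lang, *SL₂(ℝ)*, GTM 105, Ch. I §1 (Bruhat/Iwasawa vocabulary; the identity is elementary).
-/

set_option autoImplicit false

noncomputable section

namespace Literature.LinearAlgebra.Matrix.RotationThreeShears

open Real

/-- `D(a)⁻¹ = D(a⁻¹)`. [folklore] -/
theorem slDiag_inv (a : ℝ) (ha : a ≠ 0) : (slDiag a ha)⁻¹ = slDiag a⁻¹ (inv_ne_zero ha) := by
  rw [inv_eq_iff_mul_eq_one]
  ext i j
  simp only [Matrix.SpecialLinearGroup.coe_mul, coe_slDiag, Matrix.SpecialLinearGroup.coe_one]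
  fin_cases i <;> fin_cases j <;> simp [Matrix.mul_apply, Fin.sum_univ_two, mul_inv_cancel₀ ha, inv_mul_cancel₀ ha]

/-- **The Weyl element inverts the split torus**: `w · D(a) · w⁻¹ = D(a⁻¹)`. [folklore] -/
theorem slWeyl_mul_slDiag_mul_slWeyl_inv (a : ℝ) (ha : a ≠ 0) :
    slWeyl * slDiag a ha * slWeyl⁻¹ = slDiag a⁻¹ (inv_ne_zero ha) := by
  rw [mul_inv_eq_iff_eq_mul]
  ext i j
  simp only [Matrix.SpecialLinearGroup.coe_mul, coe_slDiag, coe_slWeyl, weyl]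
  fin_cases i <;> fin_cases j <;> simp [Matrix.mul_apply, Fin.sum_univ_two]

/-- `D(b⁻¹) · D(b⁻¹) = D(a)` for `b = (√a)⁻¹`, `a > 0`. [folklore] -/
theorem slDiag_sqrt_inv_inv_mul_self (a : ℝ) (ha : 0 < a) :
    slDiag ((Real.sqrt a)⁻¹)⁻¹ (inv_ne_zero (inv_ne_zero (Real.sqrt_pos.2 ha).ne')) *
        slDiag ((Real.sqrt a)⁻¹)⁻¹ (inv_ne_zero (inv_ne_zero (Real.sqrt_pos.2 ha).ne')) =
      slDiag a ha.ne' := by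
  ext i j
  simp only [Matrix.SpecialLinearGroup.coe_mul, coe_slDiag, inv_inv]
  have hs : Real.sqrt a * Real.sqrt a = a := Real.mul_self_sqrt ha.le
  have hs' : (Real.sqrt a)⁻¹ * (Real.sqrt a)⁻¹ = a⁻¹ := by rw [← mul_inv, hs]
  fin_cases i <;> fin_cases j <;> simp [Matrix.mul_apply, Fin.sum_univ_two, hs, hs']

/-- **`D(a)`, `a > 0`, is one commutator**: `D(a) = w · D(b) · w⁻¹ · D(b)⁻¹` with `b = (√a)⁻¹`. [folklore] -/
theorem slDiag_eq_commutator (a : ℝ) (ha : 0 < a) :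
    slDiag a ha.ne' =
      slWeyl * slDiag (Real.sqrt a)⁻¹ (inv_ne_zero (Real.sqrt_pos.2 ha).ne') * slWeyl⁻¹ *
        (slDiag (Real.sqrt a)⁻¹ (inv_ne_zero (Real.sqrt_pos.2 ha).ne'))⁻¹ := by
  rw [slWeyl_mul_slDiag_mul_slWeyl_inv, slDiag_inv, slDiag_sqrt_inv_inv_mul_self a ha]

/-- **Homomorphisms into commutative groups kill the split torus**: `c (D(a)) = 1` for `a > 0`. [folklore] -/
theorem map_slDiag_eq_one {A : Type*} [CommGroup A] (c : Matrix.SpecialLinearGroup (Fin 2) ℝ →* A) (a : ℝ)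
    (ha : 0 < a) : c (slDiag a ha.ne') = 1 := by
  rw [slDiag_eq_commutator a ha, map_mul, map_mul, map_mul, map_inv, map_inv, mul_inv_cancel_comm, mul_inv_cancel]

/-- The hyperbolic one-parameter subgroup `t ↦ D(e^t)` lies in the kernel of every homomorphism into a commutative
group. [folklore] -/
theorem map_slDiag_exp_eq_one {A : Type*} [CommGroup A] (c : Matrix.SpecialLinearGroup (Fin 2) ℝ →* A) (t : ℝ) :
    c (slDiag (Real.exp t) (Real.exp_pos t).ne') = 1 :=
  map_slDiag_eq_one c (Real.exp t) (Real.exp_pos t)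

end Literature.LinearAlgebra.Matrix.RotationThreeShears

end
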